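import Summits.QuantumFields.BalabanUV.T4Continuum.Spine.NE3.LandauProjectionSupFlat
import Summits.QuantumFields.BalabanUV.T4Continuum.Spine.NE3.FlatLandauExpStar
import Literature.MathematicalPhysics.QuantumFieldTheory.Balaban1983to89.B7Eq31BCH
import HarnessLib

/-!
# T⁴ programme, node NE3 — [B8] AT THE FLAT BACKGROUND, brick E, letter 2a: ONE BOND OF A GAUGE STEP —
# `log(u·V·u′⁻¹) = Ad_u log V + log(u u′⁻¹) + B`, `‖B‖ ≤ 8·r·γ_u` (the MIXED second-order BCH bound), the new radius
# `‖u·V·u′⁻¹ − 1‖ ≤ ‖V − 1‖ + ‖u − u′‖`, and the letters of the exponential gauge transformation `u = e^{λ}` (`FlatLandauGaugeBond`)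

Cell `pub-balaban`, rung (B)+1 sub-cell t4, row NE3 (OWNER lineage `b2b-balaban-t4-ne3-p1`, generation 27; technique of record:
implicit-function ∕ contraction mapping).  Second file of the chain «BRICK E OF REP♭ AT FLAT PAIRS» (the EXACT nonlinear
(1.38)-Landau step of [Balaban1985RegularSpaces] Sect. E, Prop. 5 pp. 89–94, AT THE FLAT BACKGROUND on the T⁴ programme's lattice;
asked of «row NE3's owner» by the CRUX prover NE7: HOME/INBOX [NE7P1-G72-INBOX-4], crux card
`t4/b2b-balaban-t4-ne7-p1-g72/REP-FLAT-CRUX-CARD.md` N3, road `t4/b2b-balaban-t4-ne7-p1-g73/REP-FLAT-ROAD-v2.md` §4 brick E).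
The bond-level letters of one Newton step `V ↦ V^{u}`, `u = e^{λ}`; the site-level divergence identity is letter 2b
`Spine/NE3/FlatLandauGaugeStep`.

MECHANISM (bond `(x, μ)`, `u = u(x)`, `u′ = u(x + e_μ)`): `u·V·u′⁻¹ = Ṽ·g` with `Ṽ := u V u⁻¹` (unitary, `log Ṽ = Ad_u log V`, tree
`B7Prop1Explicit.mlog_units_conj`) and the PURE GAUGE `g := u u′⁻¹`, `‖g − 1‖ ≤ ‖u − u′‖`; `log(Ṽg) = log Ṽ + log g + B` with
`‖B‖ ≤ 2‖log Ṽ‖‖log g‖ ≤ 8·r·γ_u` by the tree's MIXED bound [Balaban1985Averaging] (31) `B7Eq31BCH.eq31_printed` — proportional to the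
gauge step AND to the field, which is what a contraction needs (the symmetric bound `4(p+q)²` of `B12Average05And08.norm_mlog_mul_sub_le`
would leave a `‖log V‖²` term that does not vanish at `λ = 0`).

WHAT ([folklore]; `n : Type*` finite nonempty; 0 def, 0 sorry):
* §1 letters: `exp_tenth_le`, `mlog_inv_unit` (`log w⁻¹ = −log w`, unit `‖w − 1‖ ≤ 1∕4`), `norm_Ad_sub_Ad_le` (`‖Ad_v X − Ad_w X‖ ≤ 2‖v − w‖‖X‖`,
  unitary), `expGauge_unitary`, `norm_expGauge_sub_one_le` (`‖e^{λ} − 1‖ ≤ 2Λ`), `norm_expGauge_sub_expGauge_le` (`≤ (5∕4)‖λ(y) − λ(y′)‖`).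
* §2 `norm_pureGauge_sub_one_le`, `gaugeBond_eq`, **`norm_gaugeBond_sub_one_le`** (new radius), **`norm_mlog_gaugeBond_sub_le`** (the mixed
  BCH bound on one bond), `mlog_mem_skewAdjoint_of_unitary`.

HONEST FRAMING (page 1): elementary Banach-algebra ∕ lattice letters about OUR objects; nothing of Bałaban's is used, asserted or discharged;
brick E is NOT landed by this file; REP♭ NOT proved; NE3 ∕ NE7 NOT proved; spine PROVED 0∕9; finite T⁴ rung (B)+1 — NOT infinite volume, NOT
mass gap, NOT `BetaPertH`, NOT Clay.  Continuum YM on T⁴ ⇐ BetaPertH ∧ nine spine estimates (0/9 proved); BetaPertH ⇐ (D1) ∧ (D4) ∧ CAP+tail;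
G-an2-4 gates asym, D1 and NE2/3/4.  PLACEMENT: our lemma, `Spine/NE3/`; imports row NE3's flat Landau letters (`Spine/NE3/LandauProjectionSupFlat`),
letter 1 `FlatLandauExpStar`, and `B7Eq31BCH`.
-/

set_option autoImplicit false

open NormedSpace
open scoped BigOperators Matrix.Norms.L2Operator
open Finset

namespace Summit.QuantumFields.BalabanUV.T4Continuum.NE3.FlatLandauGaugeBond

open Literature.MathematicalPhysics.QuantumFieldTheory.Balaban1983to89
open B7Prop1Explicit B7Prop2Explicit MatrixLog
open T4AveragingDeficitWall (Ad IsUnitaryCfg IsSkewDir)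
open T4AveragingDeficitWallBoundary (IsPeriodicCfg periodBox)
open AveragingDeficitPeriodicCounting (IsPeriodicDir)
open AveragingDeficitNearIdentity (norm_Ad_sub_le)
open AveragingDeficitTransport (norm_Ad_of_unitary mem_U1_of_unitary)
open MinimalActionWitness (flatCfg)
open NE3EnergyShapes (IsUnitarySite IsPeriodicSite)
open NE3CovariantWeitzenbock (covDiv covDiv_flatCfg)
open NE3.PairLandauB8 (covLapSite)
open NE3.LandauCorrectionSupB8FlatH0 (covLapSite_flatCfg_eq_neg_laplacian)
open NE7ExpLogSecondOrder (norm_expTail_sub_expTail_le real_exp_sub_one_le_two_mul)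

noncomputable section

variable {d : ℕ} {n : Type*} [Fintype n] [DecidableEq n]

local notation "𝕄" => Matrix n n ℂ

/-! ## §1 Letters: the inverse logarithm, conjugation defects, the exponential gauge transformation -/

/-- `e^{1∕10} ≤ 5∕4` (from the tree's `e^{1∕5} ≤ 11∕9`). [folklore] -/
theorem exp_tenth_le : Real.exp (1 / 10) ≤ 5 / 4 :=
  ((Real.exp_le_exp.mpr (by norm_num)).trans B7Eq31BCH.exp_one_fifth_le).trans (by norm_num)

/-- **`log w⁻¹ = −log w`** for a unit `w` with `‖w − 1‖ ≤ 1∕4` (`w⁻¹ = e^{−log w}` and `log e^{C} = C` on `‖C‖ < ln 2`). [folklore] -/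
theorem mlog_inv_unit {w : 𝕄ˣ} (hw : ‖(w : 𝕄) - 1‖ ≤ 1 / 4) :
    mlog (((w⁻¹ : 𝕄ˣ) : 𝕄)) = -mlog (w : 𝕄) := by
  have hY : ‖mlog (w : 𝕄)‖ ≤ 1 / 2 := (norm_mlog_le_two_mul (by linarith)).trans (by linarith)
  have hexp : ((w : 𝕄ˣ) : 𝕄) = exp (mlog (w : 𝕄)) := (exp_mlog (by linarith)).symm
  rw [units_val_inv_eq_exp_neg hexp]
  refine B7BlockAvgLog.mlog_exp ?_
  rw [norm_neg]
  have := Real.log_two_gt_d9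
  linarith

/-- **CONJUGATION DEFECT BETWEEN TWO UNITARIES**: `‖Ad_v X − Ad_w X‖ ≤ 2‖v − w‖·‖X‖` (`Ad_v X − Ad_w X = (v − w)Xv⁻¹ + wX(v⁻¹ − w⁻¹)`,
`v⁻¹ − w⁻¹ = v⁻¹(w − v)w⁻¹`, unitaries have norm `1`). [folklore] -/
theorem norm_Ad_sub_Ad_le [Nonempty n] {v w : 𝕄ˣ} (hv : v ∈ unitaryUnits 𝕄) (hw : w ∈ unitaryUnits 𝕄) (X : 𝕄) :
    ‖Ad v X - Ad w X‖ ≤ 2 * ‖(v : 𝕄) - w‖ * ‖X‖ := by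
  have hv1 : ‖((v⁻¹ : 𝕄ˣ) : 𝕄)‖ = 1 := CStarRing.norm_of_mem_unitary (mem_unitaryUnits.mp ((unitaryUnits 𝕄).inv_mem hv))
  have hw1 : ‖((w⁻¹ : 𝕄ˣ) : 𝕄)‖ = 1 := CStarRing.norm_of_mem_unitary (mem_unitaryUnits.mp ((unitaryUnits 𝕄).inv_mem hw))
  have hw0 : ‖(w : 𝕄)‖ = 1 := CStarRing.norm_of_mem_unitary (mem_unitaryUnits.mp hw)
  have hinv : ((v⁻¹ : 𝕄ˣ) : 𝕄) - ((w⁻¹ : 𝕄ˣ) : 𝕄) = ((v⁻¹ : 𝕄ˣ) : 𝕄) * ((w : 𝕄) - v) * ((w⁻¹ : 𝕄ˣ) : 𝕄) := by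
    rw [mul_sub, sub_mul, mul_assoc _ (w : 𝕄) _, Units.mul_inv, mul_one, Units.inv_mul, one_mul]
  have e1 : Ad v X - Ad w X = ((v : 𝕄) - w) * X * ((v⁻¹ : 𝕄ˣ) : 𝕄) + (w : 𝕄) * X * (((v⁻¹ : 𝕄ˣ) : 𝕄) - ((w⁻¹ : 𝕄ˣ) : 𝕄)) := by
    unfold Ad; noncomm_ring
  rw [e1]
  calc ‖((v : 𝕄) - w) * X * ((v⁻¹ : 𝕄ˣ) : 𝕄) + (w : 𝕄) * X * (((v⁻¹ : 𝕄ˣ) : 𝕄) - ((w⁻¹ : 𝕄ˣ) : 𝕄))‖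
      ≤ ‖(v : 𝕄) - w‖ * ‖X‖ * ‖((v⁻¹ : 𝕄ˣ) : 𝕄)‖ + ‖(w : 𝕄)‖ * ‖X‖ * ‖((v⁻¹ : 𝕄ˣ) : 𝕄) - ((w⁻¹ : 𝕄ˣ) : 𝕄)‖ :=
        (norm_add_le _ _).trans (add_le_add ((norm_mul_le _ _).trans (mul_le_mul_of_nonneg_right (norm_mul_le _ _) (norm_nonneg _)))
          ((norm_mul_le _ _).trans (mul_le_mul_of_nonneg_right (norm_mul_le _ _) (norm_nonneg _))))
    _ ≤ ‖(v : 𝕄) - w‖ * ‖X‖ * 1 + 1 * ‖X‖ * (1 * ‖(w : 𝕄) - v‖ * 1) := by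
        rw [hv1, hw0, hinv]
        gcongr
        calc _ ≤ ‖((v⁻¹ : 𝕄ˣ) : 𝕄) * ((w : 𝕄) - v)‖ * ‖((w⁻¹ : 𝕄ˣ) : 𝕄)‖ := norm_mul_le _ _
          _ ≤ ‖((v⁻¹ : 𝕄ˣ) : 𝕄)‖ * ‖(w : 𝕄) - v‖ * ‖((w⁻¹ : 𝕄ˣ) : 𝕄)‖ := by gcongr; exact norm_mul_le _ _
          _ = 1 * ‖(w : 𝕄) - v‖ * 1 := by rw [hv1, hw1]
    _ = 2 * ‖(v : 𝕄) - w‖ * ‖X‖ := by rw [norm_sub_rev (w : 𝕄)]; ring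

section ExpGauge

/-- The exponential of a skew site field is a unitary gauge transformation. [folklore] -/
theorem expGauge_unitary {lam : Site d → 𝕄} {u : Site d → 𝕄ˣ} (hlams : ∀ y, lam y ∈ skewAdjoint 𝕄)
    (hu : ∀ y, (u y : 𝕄) = exp (lam y)) : IsUnitarySite u := fun y => by
  letI : NormedAlgebra ℚ 𝕄 := NormedAlgebra.restrictScalars ℚ ℂ 𝕄
  exact mem_unitaryUnits.mpr (by rw [hu y]; exact NormedSpace.exp_mem_unitary_of_mem_skewAdjoint (hlams y))

/-- `‖e^{λ(y)} − 1‖ ≤ 2Λ` on `‖λ‖ ≤ Λ ≤ 1`. [folklore] -/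
theorem norm_expGauge_sub_one_le {lam : Site d → 𝕄} {u : Site d → 𝕄ˣ} (hu : ∀ y, (u y : 𝕄) = exp (lam y)) {Λ : ℝ} (hΛ : ∀ y, ‖lam y‖ ≤ Λ) (hΛ1 : Λ ≤ 1) (y : Site d) :
    ‖(u y : 𝕄) - 1‖ ≤ 2 * Λ := by
  have hΛ0 : 0 ≤ Λ := (norm_nonneg _).trans (hΛ y)
  rw [hu y]
  exact (norm_exp_sub_one_le_of_norm_le (hΛ y)).1.trans (real_exp_sub_one_le_two_mul hΛ0 hΛ1)

/-- `‖e^{λ(y)} − e^{λ(y′)}‖ ≤ (5∕4)‖λ(y) − λ(y′)‖` on `‖λ‖ ≤ Λ ≤ 1∕10` (`e^a − e^b = (a − b) + (T a − T b)`, tree Lipschitz bound of the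
tail `T`, `e^{1∕10} ≤ 5∕4`). [folklore] -/
theorem norm_expGauge_sub_expGauge_le [Nonempty n] {lam : Site d → 𝕄} {u : Site d → 𝕄ˣ} (hu : ∀ y, (u y : 𝕄) = exp (lam y)) {Λ : ℝ} (hΛ : ∀ y, ‖lam y‖ ≤ Λ) (hΛ1 : Λ ≤ 1 / 10)
    (y y' : Site d) : ‖(u y : 𝕄) - u y'‖ ≤ 5 / 4 * ‖lam y - lam y'‖ := by
  have hT := norm_expTail_sub_expTail_le (hΛ y) (hΛ y')
  have hid : (u y : 𝕄) - u y' = (lam y - lam y') + ((exp (lam y) - 1 - lam y) - (exp (lam y') - 1 - lam y')) := by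
    rw [hu y, hu y']; abel
  rw [hid]
  have hE : Real.exp Λ ≤ 5 / 4 := (Real.exp_le_exp.mpr hΛ1).trans exp_tenth_le
  calc ‖(lam y - lam y') + ((exp (lam y) - 1 - lam y) - (exp (lam y') - 1 - lam y'))‖
      ≤ ‖lam y - lam y'‖ + (Real.exp Λ - 1) * ‖lam y - lam y'‖ := (norm_add_le _ _).trans (add_le_add le_rfl hT)
    _ = Real.exp Λ * ‖lam y - lam y'‖ := by ring
    _ ≤ 5 / 4 * ‖lam y - lam y'‖ := mul_le_mul_of_nonneg_right hE (norm_nonneg _)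

end ExpGauge

/-! ## §2 One bond: `log(u·V·u′⁻¹) = Ad_u log V + log(u u′⁻¹) + B`, `‖B‖ ≤ 8·r·γ_u` -/

section Bond

variable [Nonempty n]

/-- `u u′⁻¹ − 1 = (u − u′)u′⁻¹`, so `‖u u′⁻¹ − 1‖ ≤ ‖u − u′‖` for unitary `u′`. [folklore] -/
theorem norm_pureGauge_sub_one_le {u u' : 𝕄ˣ} (hu' : u' ∈ unitaryUnits 𝕄) :
    ‖((u * u'⁻¹ : 𝕄ˣ) : 𝕄) - 1‖ ≤ ‖(u : 𝕄) - u'‖ := by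
  have h1 : ‖((u'⁻¹ : 𝕄ˣ) : 𝕄)‖ = 1 := CStarRing.norm_of_mem_unitary (mem_unitaryUnits.mp ((unitaryUnits 𝕄).inv_mem hu'))
  have hid : ((u * u'⁻¹ : 𝕄ˣ) : 𝕄) - 1 = ((u : 𝕄) - u') * ((u'⁻¹ : 𝕄ˣ) : 𝕄) := by
    rw [Units.val_mul, sub_mul, Units.mul_inv]
  rw [hid]
  calc _ ≤ ‖(u : 𝕄) - u'‖ * ‖((u'⁻¹ : 𝕄ˣ) : 𝕄)‖ := norm_mul_le _ _
    _ = ‖(u : 𝕄) - u'‖ := by rw [h1, mul_one]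

omit [Nonempty n] in
/-- `u·V·u′⁻¹ = (Ad_u V)·(u u′⁻¹)`. [folklore] -/
theorem gaugeBond_eq (u V u' : 𝕄ˣ) : ((u * V * u'⁻¹ : 𝕄ˣ) : 𝕄) = Ad u (V : 𝕄) * ((u * u'⁻¹ : 𝕄ˣ) : 𝕄) := by
  simp only [Ad, Units.val_mul, mul_assoc, Units.inv_mul_cancel_left]

/-- **THE NEW RADIUS ON ONE BOND**: `‖u·V·u′⁻¹ − 1‖ ≤ ‖V − 1‖ + ‖u − u′‖` (unitary `u, V, u′`: `Ad_u V·(g − 1) + (Ad_u V − 1)`,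
`‖Ad_u V‖ = 1`, `Ad_u V − 1 = Ad_u(V − 1)`). [folklore] -/
theorem norm_gaugeBond_sub_one_le {V u u' : 𝕄ˣ} (hV : V ∈ unitaryUnits 𝕄) (hu : u ∈ unitaryUnits 𝕄) (hu' : u' ∈ unitaryUnits 𝕄) :
    ‖((u * V * u'⁻¹ : 𝕄ˣ) : 𝕄) - 1‖ ≤ ‖(V : 𝕄) - 1‖ + ‖(u : 𝕄) - u'‖ := by
  rw [gaugeBond_eq]
  have hAd1 : Ad u (V : 𝕄) - 1 = Ad u ((V : 𝕄) - 1) := by unfold Ad; rw [mul_sub, sub_mul, mul_one, Units.mul_inv]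
  have hnA : ‖Ad u (V : 𝕄)‖ = 1 := by rw [norm_Ad_of_unitary hu, CStarRing.norm_of_mem_unitary (mem_unitaryUnits.mp hV)]
  have hid : Ad u (V : 𝕄) * ((u * u'⁻¹ : 𝕄ˣ) : 𝕄) - 1 = Ad u (V : 𝕄) * (((u * u'⁻¹ : 𝕄ˣ) : 𝕄) - 1) + (Ad u (V : 𝕄) - 1) := by
    noncomm_ring
  rw [hid]
  calc _ ≤ ‖Ad u (V : 𝕄) * (((u * u'⁻¹ : 𝕄ˣ) : 𝕄) - 1)‖ + ‖Ad u (V : 𝕄) - 1‖ := norm_add_le _ _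
    _ ≤ ‖Ad u (V : 𝕄)‖ * ‖((u * u'⁻¹ : 𝕄ˣ) : 𝕄) - 1‖ + ‖Ad u ((V : 𝕄) - 1)‖ := by rw [hAd1]; gcongr; exact norm_mul_le _ _
    _ ≤ 1 * ‖(u : 𝕄) - u'‖ + ‖(V : 𝕄) - 1‖ := by
        rw [hnA, norm_Ad_of_unitary hu]; gcongr; exact norm_pureGauge_sub_one_le hu'
    _ = ‖(V : 𝕄) - 1‖ + ‖(u : 𝕄) - u'‖ := by ring

/-- **THE MIXED BCH BOUND ON ONE BOND** ([Balaban1985Averaging] (31), tree `B7Eq31BCH.eq31_printed`, read for the pair `Ṽ = u V u⁻¹`,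
`g = u u′⁻¹`): for unitary `V, u, u′` with `‖V − 1‖ ≤ r ≤ 1∕20` and `‖u − u′‖ ≤ γ_u ≤ 1∕20`,
`‖log(u V u′⁻¹) − Ad_u log V − log(u u′⁻¹)‖ ≤ 8·r·γ_u` — PROPORTIONAL to the gauge step AND to the field. [folklore] -/
theorem norm_mlog_gaugeBond_sub_le {V u u' : 𝕄ˣ} (hu : u ∈ unitaryUnits 𝕄) (hu' : u' ∈ unitaryUnits 𝕄)
    {r γu : ℝ} (hr : ‖(V : 𝕄) - 1‖ ≤ r) (hr1 : r ≤ 1 / 20) (hγ : ‖(u : 𝕄) - u'‖ ≤ γu) (hγ1 : γu ≤ 1 / 20) :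
    ‖mlog ((u * V * u'⁻¹ : 𝕄ˣ) : 𝕄) - Ad u (mlog (V : 𝕄)) - mlog ((u * u'⁻¹ : 𝕄ˣ) : 𝕄)‖ ≤ 8 * r * γu := by
  have hr0 : 0 ≤ r := (norm_nonneg _).trans hr
  have hγ0 : 0 ≤ γu := (norm_nonneg _).trans hγ
  -- `X := log Ṽ = Ad_u log V`, `‖X‖ ≤ 2r`
  have hV1 : ‖(V : 𝕄) - 1‖ < 1 := by linarith
  have hAd1 : Ad u (V : 𝕄) - 1 = Ad u ((V : 𝕄) - 1) := by unfold Ad; rw [mul_sub, sub_mul, mul_one, Units.mul_inv]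
  have hVt1 : ‖Ad u (V : 𝕄) - 1‖ < 1 := by rw [hAd1, norm_Ad_of_unitary hu]; exact hV1
  have hX : mlog (Ad u (V : 𝕄)) = Ad u (mlog (V : 𝕄)) := by
    unfold Ad; exact mlog_units_conj (mem_U1_of_unitary hu) hV1
  have hXn : ‖Ad u (mlog (V : 𝕄))‖ ≤ 2 * r := by
    rw [norm_Ad_of_unitary hu]; exact (norm_mlog_le_two_mul (by linarith)).trans (by linarith)
  have hexpX : exp (Ad u (mlog (V : 𝕄))) = Ad u (V : 𝕄) := by rw [← hX]; exact exp_mlog hVt1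
  -- `Y := log g`, `‖Y‖ ≤ 2γ_u`
  have hg : ‖((u * u'⁻¹ : 𝕄ˣ) : 𝕄) - 1‖ ≤ γu := (norm_pureGauge_sub_one_le hu').trans hγ
  have hYn : ‖mlog ((u * u'⁻¹ : 𝕄ˣ) : 𝕄)‖ ≤ 2 * γu := (norm_mlog_le_two_mul (by linarith)).trans (by linarith)
  have hexpY : exp (mlog ((u * u'⁻¹ : 𝕄ˣ) : 𝕄)) = ((u * u'⁻¹ : 𝕄ˣ) : 𝕄) := exp_mlog (by linarith)
  have h31 := B7Eq31BCH.eq31_printed (X := Ad u (mlog (V : 𝕄))) (Y := mlog ((u * u'⁻¹ : 𝕄ˣ) : 𝕄)) (by linarith) (by linarith)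
  rw [hexpX, hexpY, ← gaugeBond_eq] at h31
  calc _ ≤ 2 * ‖Ad u (mlog (V : 𝕄))‖ * ‖mlog ((u * u'⁻¹ : 𝕄ˣ) : 𝕄)‖ := h31
    _ ≤ 2 * (2 * r) * (2 * γu) := by gcongr
    _ = 8 * r * γu := by ring

omit [Nonempty n] in
/-- The logarithm of a unitary unit within `1∕4` of `1` is skew-adjoint ([Balaban1985Averaging] (22)–(23), tree `star_mlog_eq_neg`). [folklore] -/
theorem mlog_mem_skewAdjoint_of_unitary {w : 𝕄ˣ} (hw : w ∈ unitaryUnits 𝕄) (h : ‖(w : 𝕄) - 1‖ ≤ 1 / 4) :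
    mlog (w : 𝕄) ∈ skewAdjoint 𝕄 := by
  letI : NormedAlgebra ℚ 𝕄 := NormedAlgebra.restrictScalars ℚ ℝ 𝕄
  letI : CStarAlgebra 𝕄 := {}
  have h1 := UnitaryRootInterpolation.smul_mlog_mem_skewAdjoint (mem_unitaryUnits.mp hw) h 1
  rwa [one_smul] at h1

end Bond

end

end Summit.QuantumFields.BalabanUV.T4Continuum.NE3.FlatLandauGaugeBond
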